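import Mathlib.RingTheory.HahnSeries.Summable
import Mathlib.RingTheory.HahnSeries.Valuation
import Mathlib.RingTheory.Valuation.ValuationSubring
import Mathlib.Algebra.Order.Monoid.Submonoid
import Mathlib.FieldTheory.Finite.Basic
import HarnessLib

/-!
# Crux `Steer` (stmt-16345), chain W4.1 / kill test K4.1b: definitions for the kernel inhabitant of the dim-`≥ 4` Steer core

OURS (campaign `res-hironaka`, rung L, slot W4.1; replaces the role of no printed item; NOT a statement of
the manuscript under review). The objects of the EXPLICIT datum inhabiting the registered open stub
`Sig.stub_steerDefectCore4` (line `switching_dichotomy`), kill test K4.1b «ALIVE-BY-KERNEL» (seat res-L0-k41;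
certificate `HOME/L/res-L0-w41-stub-4/CORE4-INHABITANT.md`, whose cited existence theorem — F.-V. Kuhlmann,
Trans. AMS 356 (2004), Thm 1.1: a valuation on `k(x₁,…,x₄)` with value group `ℤ[1/p]` and residue field `k` —
these definitions replace by an explicit construction). Definitions only (reviewed file); all lemmas live in
the sibling proof files `…Core4HahnValuation.lean`, `…Core4KuhlmannSeries.lean`, `…Core4HahnTranscendence.lean`,
`…Core4HahnInhabitant.lean`.

* `PInv p` — `ℤ[1/p] ⊂ ℚ` as an ordered additive subgroup (the value group).
* `hahnVal Γ k`, `𝒪 Γ k` — the order valuation of the Hahn-series field `k⟦x^Γ⟧` and its valuation ring.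
* `Ω p = 𝔽_p⟦x^{ℤ[1/p]}⟧`, `one' p = 1 ∈ ℤ[1/p]`, `xElt p = x`.
* `R j = j(j+1)/2`, `expo p j = j + p^{-R j}`, `tailSer p j = Σ_{i>j} x^{expo i}`, `kser p = tailSer p 0`
  (a Kuhlmann-type series), `zElt p j = (tailSer p j)^(p^(R j))`, `mExp p j = (j+1)p^{R(j+1)} + 1`.

No `Theses.*` / `Cruxes.*` import (chain build rule, CHAIN W4.1 §imports).
-/

-- layout-mandated namespace `Summit.<Summit>.<Problem>.…` with Summit = Problem (single-conjunct summit)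
set_option linter.dupNamespace false

namespace Summit.ResolutionOfSingularities.ResolutionOfSingularities.Theorems.SwitchingDichotomy.Core4Hahn

open HahnSeries

/-- `ℤ[1/p] ⊂ ℚ`: the rationals `q` with `q * p ^ n ∈ ℤ` for some `n` (for a prime `p`, the rationals of the
form `m / p ^ n`). [folklore] -/
def PInv (p : ℕ) : AddSubgroup ℚ where
  carrier := {q | ∃ n : ℕ, ∃ m : ℤ, q * (p : ℚ) ^ n = m}
  zero_mem' := ⟨0, 0, by simp⟩
  add_mem' := by
    rintro q₁ q₂ ⟨n₁, m₁, h₁⟩ ⟨n₂, m₂, h₂⟩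
    refine ⟨n₁ + n₂, m₁ * p ^ n₂ + m₂ * p ^ n₁, ?_⟩
    push_cast
    rw [← h₁, ← h₂]
    ring
  neg_mem' := by
    rintro q ⟨n, m, h⟩
    exact ⟨n, -m, by push_cast; rw [← h]; ring⟩

/-- Membership in `ℤ[1/p]`. [folklore] -/
theorem mem_PInv_iff {p : ℕ} {q : ℚ} : q ∈ PInv p ↔ ∃ n : ℕ, ∃ m : ℤ, q * (p : ℚ) ^ n = m := Iff.rfl

/-- Integers lie in `ℤ[1/p]`. [folklore] -/
theorem intCast_mem_PInv (p : ℕ) (m : ℤ) : (m : ℚ) ∈ PInv p := ⟨0, m, by simp⟩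

/-- Naturals lie in `ℤ[1/p]`. [folklore] -/
theorem natCast_mem_PInv (p n : ℕ) : (n : ℚ) ∈ PInv p := ⟨0, n, by simp⟩

/-! ## The order valuation of a Hahn-series field and its valuation ring -/

section General

variable (Γ : Type*) [AddCommGroup Γ] [LinearOrder Γ] [IsOrderedAddMonoid Γ] (k : Type*) [Field k]

/-- The `x`-adic (order) valuation of `HahnSeries Γ k`, multiplicatively written (Mathlib's `HahnSeries.addVal`
read through `AddValuation.toValuation`): `v h = ofAdd (toDual h.orderTop)`. [folklore] -/
noncomputable def hahnVal : Valuation (HahnSeries Γ k) (Multiplicative (WithTop Γ)ᵒᵈ) :=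
  AddValuation.toValuation (HahnSeries.addVal Γ k)

/-- The valuation ring `𝒪 = {h | 0 ≤ orderTop h}` of the order valuation. [folklore] -/
noncomputable def 𝒪 : ValuationSubring (HahnSeries Γ k) :=
  (hahnVal Γ k).valuationSubring

end General

/-! ## The datum's ambient field, its «generic» power series and its Kuhlmann-type series -/

section Datum

variable (p : ℕ)

/-- The ambient field `Ω = 𝔽_p⟦x^{ℤ[1/p]}⟧`. -/
abbrev Ω : Type := HahnSeries (PInv p) (ZMod p)

/-- The exponent `1 ∈ ℤ[1/p]` (the value of `x`). -/
def one' : PInv p := ⟨1, by simpa using natCast_mem_PInv p 1⟩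

/-- `x = single 1 1 ∈ Ω`. -/
noncomputable def xElt : Ω p := single (one' p) 1

/-- Triangular numbers, recursively: `R 0 = 0`, `R (j+1) = R j + (j+1)`. -/
def R : ℕ → ℕ
  | 0 => 0
  | j + 1 => R j + (j + 1)

/-- The integer `m (j+1) = (j+1) p^{R (j+1)} + 1`, exponent of `x` in the recursion for `zElt`. -/
def mExp (j : ℕ) : ℕ := (j + 1) * p ^ R (j + 1) + 1

/-- The exponents `(n+1) • 1`, `n ∈ ℕ` (support of the «generic» power series). -/
def natSupp : Set (PInv p) := Set.range fun n : ℕ => (n + 1) • one' p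

/-- `n ↦ (n+1) • 1` is monotone. -/
theorem natSupp_monotone : Monotone fun n : ℕ => (n + 1) • one' p := by
  intro a b hab
  have h1 : (0 : PInv p) ≤ one' p := by
    show (0 : ℚ) ≤ (one' p : PInv p)
    simp [one']
  exact nsmul_le_nsmul_left h1 (by omega)

/-- `natSupp` is partially well ordered. -/
theorem natSupp_isPWO : (natSupp p).IsPWO := by
  rw [natSupp, ← Set.image_univ]
  exact (Set.isPWO_of_wellQuasiOrderedLE _).image_of_monotone (natSupp_monotone p)

/-- The power series `Σ_{n ≥ 0} c n · x^{n+1}` attached to a coefficient sequence `c : ℕ → 𝔽_p` (an injection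
of the uncountable set `ℕ → 𝔽_p` into the maximal ideal of `𝒪`, used to pick generators transcendental over a
countable subfield). -/
noncomputable def natSer (c : ℕ → ZMod p) : Ω p where
  coeff g := by
    classical
    exact if h : g ∈ natSupp p then c (Classical.choose h) else 0
  isPWO_support' := by
    classical
    refine (natSupp_isPWO p).mono ?_
    intro g hg
    by_contra h
    exact hg (by simp [h])

variable [hp : Fact p.Prime]

/-- `1 / p ^ n ∈ ℤ[1/p]` (membership witness used by `expo`). [folklore] -/
theorem inv_pow_mem_PInv' (n : ℕ) : ((p : ℚ) ^ n)⁻¹ ∈ PInv p :=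
  ⟨n, 1, by rw [inv_mul_cancel₀ (pow_ne_zero _ (Nat.cast_ne_zero.mpr hp.out.ne_zero))]; simp⟩

/-- The exponents `e j = j + p^{-R j} ∈ ℤ[1/p]`. -/
def expo (j : ℕ) : PInv p :=
  ⟨(j : ℚ) + ((p : ℚ) ^ R j)⁻¹, add_mem (natCast_mem_PInv p j) (inv_pow_mem_PInv' p _)⟩

/-- The exponents increase (weakly) — needed to build the tails as Hahn series. -/
theorem expo_monotone : Monotone (expo p) := by
  refine monotone_nat_of_le_succ fun j => ?_
  show ((expo p j : PInv p) : ℚ) ≤ (expo p (j + 1) : PInv p)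
  have h0 : (0 : ℚ) < p := Nat.cast_pos.mpr hp.out.pos
  have h1 : ((p : ℚ) ^ R j)⁻¹ ≤ 1 :=
    inv_le_one_of_one_le₀ (one_le_pow₀ (by exact_mod_cast hp.out.one_lt.le))
  have h2 : (0 : ℚ) < ((p : ℚ) ^ R (j + 1))⁻¹ := inv_pos.mpr (pow_pos h0 _)
  show (j : ℚ) + ((p : ℚ) ^ R j)⁻¹ ≤ ((j + 1 : ℕ) : ℚ) + ((p : ℚ) ^ R (j + 1))⁻¹
  push_cast
  linarith

/-- The support set of the `j`-th tail: `{e i | j < i}`. -/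
def tailSupp (j : ℕ) : Set (PInv p) := expo p '' {i | j < i}

/-- The tail supports are partially well ordered (images of `ℕ` under a monotone map). -/
theorem tailSupp_isPWO (j : ℕ) : (tailSupp p j).IsPWO :=
  (Set.isPWO_of_wellQuasiOrderedLE _).image_of_monotone (expo_monotone p)

/-- The `j`-th tail `Σ_{i > j} x^{e i}` (all coefficients `1`). -/
noncomputable def tailSer (j : ℕ) : Ω p where
  coeff g := by
    classical
    exact if g ∈ tailSupp p j then 1 else 0
  isPWO_support' := by
    classical
    refine (tailSupp_isPWO p j).mono ?_
    intro g hg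
    by_contra h
    exact hg (by simp [h])

/-- The Kuhlmann-type series `κ = Σ_{j ≥ 1} x^{e j}` (the datum's third generator, before Frobenius). -/
noncomputable def kser : Ω p := tailSer p 0

/-- `zElt j := (tailSer j) ^ (p ^ R j)` — the elements of `𝔽_p[x, κ]` with values `(j+1)p^{R j} + p^{-(j+1)}`. -/
noncomputable def zElt (j : ℕ) : Ω p := tailSer p j ^ p ^ R j

end Datum

end Summit.ResolutionOfSingularities.ResolutionOfSingularities.Theorems.SwitchingDichotomy.Core4Hahn
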